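import Mathlib.Analysis.Normed.Group.Tannery
import Literature.MathematicalPhysics.KineticTheory.FluctuationSpace
import HarnessLib

/-!
# Non-negativity of the zero-wavenumber structure factor from summable clustering (Følner average)

Topic `Literature/MathematicalPhysics/KineticTheory` (companion of `FluctuationSpace`). The field
`form_self_nonneg` of the hypothesis structure `FluctuationStructure` — `0 ≤ Σ_x Cov_μ(a, a ∘ T_x)`,
"positivity of the static structure factor at zero wavenumber" (Doyon 2022 Lemma 4.5; Spohn 1991
Part I (7.6)) — is, as the docstring of that structure says, a CONSEQUENCE of the other fields for the
lattice `G = ℤ`: by stationarity `Cov(a∘T_i, a∘T_j) = c(j-i)` with `c(x) = Cov(a, a∘T_x)`, so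
`0 ≤ n⁻¹ Var(Σ_{i<n} a∘T_i) = Σ_d (N_n(d)/n) c(d)` where `N_n(d) = #{(i,j) ∈ [0,n)² : j - i = d}`
satisfies `n - |d| ≤ N_n(d) ≤ n`; by Tannery's theorem (dominated convergence for series, bound `|c|`)
the right-hand side tends to `Σ_d c(d)`, which is therefore `≥ 0`. We prove exactly this
(`tsum_covariance_comp_shift_nonneg`) and its counting-measure form
(`integral_count_covariance_comp_shift_nonneg`, the literal shape of `form_self_nonneg` at
`ν = Measure.count`), for any probability space with a measure-preserving `ShiftAction ℤ`.
Everything is proved; tagged `[folklore]`. No definitions, no named facts.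
-/

noncomputable section

open MeasureTheory ProbabilityTheory Filter Set Function
open scoped Topology

namespace Literature.MathematicalPhysics.KineticTheory

variable {Ω : Type*} [MeasurableSpace Ω] {μ : Measure Ω}

/-- **Stationarity of the two-point function**: `Cov_μ(a∘T_i, a∘T_j) = Cov_μ(a, a∘T_{j-i})` for a
measure-preserving shift action. [folklore] -/
theorem covariance_comp_shift_comp_shift (T : ShiftAction ℤ Ω) (hT : ∀ x, MeasurePreserving (T x) μ μ)
    {a : Ω → ℝ} (ha : AEStronglyMeasurable a μ) (i j : ℤ) :
    cov[a ∘ T i, a ∘ T j; μ] = cov[a, a ∘ T (j - i); μ] := by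
  have hcomp : a ∘ T j = (a ∘ T (j - i)) ∘ T i := by
    funext ω
    simp only [comp_apply, ← ShiftAction.apply_add, sub_add_cancel]
  rw [hcomp]
  refine covariance_comp_measurePreserving (hT i) ha ?_
  have h : AEStronglyMeasurable a (μ.map (T (j - i))) := by rwa [(hT (j - i)).map_eq]
  exact h.comp_measurable (hT (j - i)).measurable

/-- The number of pairs `(i, j) ∈ [0,n)²` with `j - i = d`. An auxiliary count, at most `n`
(the first coordinate determines the pair). [folklore] -/
theorem card_filter_sub_eq_le (n : ℕ) (d : ℤ) :
    ((Finset.range n ×ˢ Finset.range n).filter (fun p : ℕ × ℕ => (p.2 : ℤ) - p.1 = d)).card ≤ n := by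
  classical
  calc ((Finset.range n ×ˢ Finset.range n).filter (fun p : ℕ × ℕ => (p.2 : ℤ) - p.1 = d)).card
      ≤ (Finset.range n).card := by
        refine Finset.card_le_card_of_injOn Prod.fst (fun p hp => ?_) ?_
        · exact (Finset.mem_product.1 (Finset.mem_filter.1 hp).1).1
        · intro p hp q hq h
          have hp' := (Finset.mem_filter.1 (Finset.mem_coe.1 hp)).2
          have hq' := (Finset.mem_filter.1 (Finset.mem_coe.1 hq)).2
          have h2 : (p.2 : ℤ) = q.2 := by
            have : (p.1 : ℤ) = q.1 := by exact_mod_cast h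
            linarith
          exact Prod.ext h (by exact_mod_cast h2)
    _ = n := Finset.card_range n

/-- … and at least `n - |d|` (the pairs `(i + d⁻, i + d⁺)`, `i < n - |d|`). [folklore] -/
theorem sub_abs_le_card_filter_sub_eq (n : ℕ) (d : ℤ) :
    (n : ℝ) - |(d : ℝ)| ≤
      ((Finset.range n ×ˢ Finset.range n).filter (fun p : ℕ × ℕ => (p.2 : ℤ) - p.1 = d)).card := by
  classical
  set m : ℕ := d.natAbs with hm
  have hmd : |(d : ℝ)| = (m : ℝ) := by
    rw [hm, Nat.cast_natAbs, Int.cast_abs]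
  rw [hmd]
  by_cases hnm : n ≤ m
  · have : (n : ℝ) ≤ m := by exact_mod_cast hnm
    linarith [Nat.cast_nonneg (α := ℝ)
      ((Finset.range n ×ˢ Finset.range n).filter (fun p : ℕ × ℕ => (p.2 : ℤ) - p.1 = d)).card]
  have hmn : m ≤ n := (not_le.1 hnm).le
  have hcast : (n : ℝ) - m = ((n - m : ℕ) : ℝ) := by rw [Nat.cast_sub hmn]
  rw [hcast]
  have h1 : (-d).toNat ≤ m := by rw [Int.toNat_le, hm]; push_cast [Int.natCast_natAbs]; exact neg_le_abs d
  have h2 : d.toNat ≤ m := by rw [Int.toNat_le, hm]; push_cast [Int.natCast_natAbs]; exact le_abs_self d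
  have hcard : (Finset.range (n - m)).card ≤
      ((Finset.range n ×ˢ Finset.range n).filter (fun p : ℕ × ℕ => (p.2 : ℤ) - p.1 = d)).card := by
    refine Finset.card_le_card_of_injOn (fun i => (i + (-d).toNat, i + d.toNat)) (fun i hi => ?_) ?_
    · have hi' : i < n - m := Finset.mem_range.1 hi
      refine Finset.mem_coe.2 (Finset.mem_filter.2 ⟨Finset.mem_product.2 ⟨?_, ?_⟩, ?_⟩)
      · exact Finset.mem_range.2 (show i + (-d).toNat < n by omega)
      · exact Finset.mem_range.2 (show i + d.toNat < n by omega)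
      · show ((i + d.toNat : ℕ) : ℤ) - ((i + (-d).toNat : ℕ) : ℤ) = d
        push_cast
        have := Int.toNat_sub_toNat_neg d
        linarith
    · intro i _ j _ h
      have := congrArg Prod.fst h
      simpa using this
  have := Finset.card_range (n - m) ▸ hcard
  exact_mod_cast this

/-- **Følner positivity of the summed two-point function.** On a probability space with a
measure-preserving shift action of `ℤ`, for `a ∈ L²(μ)` with summable two-point function
`x ↦ Cov_μ(a, a∘T_x)`: `0 ≤ Σ_{x ∈ ℤ} Cov_μ(a, a∘T_x)` (the Cesàro limit of
`n⁻¹ Var(Σ_{i<n} a∘T_i) ≥ 0`; Doyon 2022 Lemma 4.5 / Spohn 1991 Part I (7.6), lattice case). [folklore] -/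
theorem tsum_covariance_comp_shift_nonneg [IsProbabilityMeasure μ] (T : ShiftAction ℤ Ω)
    (hT : ∀ x, MeasurePreserving (T x) μ μ) {a : Ω → ℝ} (ha : MemLp a 2 μ)
    (hsum : Summable fun x : ℤ => cov[a, a ∘ T x; μ]) :
    0 ≤ ∑' x : ℤ, cov[a, a ∘ T x; μ] := by
  classical
  set c : ℤ → ℝ := fun x => cov[a, a ∘ T x; μ] with hc
  obtain ⟨N, hN⟩ : ∃ N : ℕ → ℤ → ℕ, ∀ (n : ℕ) (d : ℤ),
      ((Finset.range n ×ˢ Finset.range n).filter (fun p : ℕ × ℕ => (p.2 : ℤ) - p.1 = d)).card = N n d :=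
    ⟨_, fun _ _ => rfl⟩
  have hN_le : ∀ (n : ℕ) (d : ℤ), (N n d : ℝ) ≤ n := fun n d => by
    rw [← hN]; exact_mod_cast card_filter_sub_eq_le n d
  have hN_ge : ∀ (n : ℕ) (d : ℤ), (n : ℝ) - |(d : ℝ)| ≤ N n d := fun n d => by
    rw [← hN]; exact sub_abs_le_card_filter_sub_eq n d
  -- Step 1: the variance of the Birkhoff sum is `Σ_{(i,j)} c(j - i) ≥ 0`
  have hmem : ∀ i : ℕ, MemLp (a ∘ T (i : ℤ)) 2 μ := fun i => ha.comp_measurePreserving (hT i)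
  have hF : ∀ n : ℕ, 0 ≤ ∑ p ∈ Finset.range n ×ˢ Finset.range n, c ((p.2 : ℤ) - p.1) := by
    intro n
    have hvar : 0 ≤ cov[∑ i ∈ Finset.range n, a ∘ T (i : ℤ), ∑ j ∈ Finset.range n, a ∘ T (j : ℤ); μ] := by
      rw [covariance_self (memLp_finsetSum' _ fun i _ => hmem i).aestronglyMeasurable.aemeasurable]
      exact variance_nonneg _ _
    rw [covariance_sum_sum' (fun i _ => hmem i) (fun j _ => hmem j)] at hvar
    rw [Finset.sum_product]
    refine hvar.trans_eq (Finset.sum_congr rfl fun i _ => Finset.sum_congr rfl fun j _ => ?_)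
    exact covariance_comp_shift_comp_shift T hT ha.1 i j
  -- Step 2: regroup along the fibres `j - i = d`
  have hfib : ∀ n : ℕ, ∑ p ∈ Finset.range n ×ˢ Finset.range n, c ((p.2 : ℤ) - p.1) =
      ∑' d : ℤ, (N n d : ℝ) * c d := by
    intro n
    set s := Finset.range n ×ˢ Finset.range n with hs
    set t : Finset ℤ := Finset.Ioo (-(n : ℤ)) n with ht
    have hmaps : ∀ p ∈ s, ((p.2 : ℤ) - p.1) ∈ t := by
      intro p hp
      obtain ⟨h1, h2⟩ := Finset.mem_product.1 hp
      have h1' := Finset.mem_range.1 h1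
      have h2' := Finset.mem_range.1 h2
      simp only [ht, Finset.mem_Ioo]
      omega
    rw [← Finset.sum_fiberwise_of_maps_to hmaps]
    have hinner : ∀ d ∈ t, ∑ p ∈ s with ((p.2 : ℤ) - p.1 = d), c ((p.2 : ℤ) - p.1) = (N n d : ℝ) * c d := by
      intro d _
      rw [Finset.sum_congr rfl (fun p hp => by rw [(Finset.mem_filter.1 hp).2]), Finset.sum_const,
        nsmul_eq_mul, hN]
    rw [Finset.sum_congr rfl hinner]
    refine (tsum_eq_sum fun d hd => ?_).symm
    have h0 : N n d = 0 := by
      rw [← hN]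
      refine Finset.card_eq_zero.2 (Finset.filter_eq_empty_iff.2 fun p hp h => hd ?_)
      exact h ▸ hmaps p hp
    rw [h0, Nat.cast_zero, zero_mul]
  -- Step 3: the Cesàro means `G n = Σ_d (N_n(d)/n) c(d)` are `≥ 0` and tend to `Σ_d c(d)`
  have hG : ∀ n : ℕ, 0 < n → 0 ≤ ∑' d : ℤ, ((N n d : ℝ) / n) * c d := by
    intro n hn
    have h := hF n
    rw [hfib n] at h
    have e : ∑' d : ℤ, ((N n d : ℝ) / n) * c d = (n : ℝ)⁻¹ * ∑' d : ℤ, (N n d : ℝ) * c d := by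
      rw [← tsum_mul_left]
      refine tsum_congr fun d => ?_
      ring
    rw [e]
    exact mul_nonneg (by positivity) h
  have hlim : Tendsto (fun n : ℕ => ∑' d : ℤ, ((N n d : ℝ) / n) * c d) atTop (𝓝 (∑' d : ℤ, c d)) := by
    refine tendsto_tsum_of_dominated_convergence (bound := fun d => |c d|) hsum.abs (fun d => ?_) ?_
    · -- `N_n(d)/n → 1`
      have hw : Tendsto (fun n : ℕ => (N n d : ℝ) / n) atTop (𝓝 1) := by
        have hlow : Tendsto (fun n : ℕ => 1 - |(d : ℝ)| / n) atTop (𝓝 1) := by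
          have h := (tendsto_const_div_atTop_nhds_zero_nat |(d : ℝ)|)
          simpa using (tendsto_const_nhds (x := (1 : ℝ))).sub h
        refine tendsto_of_tendsto_of_tendsto_of_le_of_le' hlow tendsto_const_nhds ?_ ?_
        · filter_upwards [eventually_gt_atTop 0] with n hn
          have hn' : (0 : ℝ) < n := by exact_mod_cast hn
          rw [sub_le_iff_le_add, ← add_div, le_div_iff₀ hn', one_mul]
          linarith [hN_ge n d]
        · filter_upwards [eventually_gt_atTop 0] with n hn
          have hn' : (0 : ℝ) < n := by exact_mod_cast hn
          rw [div_le_one hn']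
          exact hN_le n d
      simpa using hw.mul_const (c d)
    · filter_upwards [eventually_gt_atTop 0] with n hn d
      have hn' : (0 : ℝ) < n := by exact_mod_cast hn
      rw [Real.norm_eq_abs, abs_mul, abs_div, Nat.abs_cast, Nat.abs_cast]
      refine mul_le_of_le_one_left (abs_nonneg _) ?_
      rw [div_le_one hn']
      exact hN_le n d
  exact ge_of_tendsto hlim ((eventually_gt_atTop 0).mono fun n hn => hG n hn)

/-- **The counting-measure form** (the literal shape of `FluctuationStructure.form_self_nonneg` at
`ν = Measure.count` on `ℤ`): if `x ↦ Cov_μ(a, a∘T_x)` is integrable for the counting measure then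
`0 ≤ ∫ Cov_μ(a, a∘T_x) d(count)`. [folklore] -/
theorem integral_count_covariance_comp_shift_nonneg [IsProbabilityMeasure μ] (T : ShiftAction ℤ Ω)
    (hT : ∀ x, MeasurePreserving (T x) μ μ) {a : Ω → ℝ} (ha : MemLp a 2 μ)
    (hint : Integrable (fun x : ℤ => cov[a, a ∘ T x; μ]) (Measure.count : Measure ℤ)) :
    0 ≤ ∫ x, cov[a, a ∘ T x; μ] ∂(Measure.count : Measure ℤ) := by
  rw [integral_countable hint]
  simp only [count_real_singleton, one_smul]
  exact tsum_covariance_comp_shift_nonneg T hT ha (integrable_count_iff.1 hint).of_norm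

end Literature.MathematicalPhysics.KineticTheory

end
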